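import Mathlib

/-!
# THE ROWS OF (Π) ARE NOT CLOSED UNDER DIRECT SUMS AT THE LEVEL OF THE RANK PROFILE (night-3 g26)

`proofs/NIGHT3-G26-TWOFLATS.md` §0 (I).  The rows `(q, u)` of the profile inequality (Π) depend on a finite matroid only
through its rank profile `N(c, f) = #{B : ρ(B) = c, ρ(E ∖ B) = f}`: the row reads
`Σ_{f ≥ u} N(q, f)·C(f, u − q) ≤ C(u, q)·Σ_f N(u, f)`, and the profile of a direct sum is the convolution of the profiles
(`N_{M ⊕ N}(c, f) = Σ N_M(c₁, f₁) N_N(c₂, f₂)` over `c₁ + c₂ = c`, `f₁ + f₂ = f`).  Adding one coloop `U_{1,1}` convolves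
with `{(0,1) ↦ 1, (1,0) ↦ 1}`: `N'(c, f) = N(c, f − 1) + N(c − 1, f)`.  The symmetric array
`N = {(0,4) ↦ 1, (4,0) ↦ 1, (1,3) ↦ 4, (3,1) ↦ 4, (2,2) ↦ 3, (2,4) ↦ 3, (4,2) ↦ 3}` (rank 4, `c + f ≥ 4` on its support)
satisfies every row `(q, u)`, `q < u ≤ 4` (`cexProfile_rows`) — and every shifted row `(R_t)`, `b, e, t ≤ 4`
(`cexProfile_shifted_rows`, appended) — while its coloop convolution fails the row `(2, 3)`: `36 > 30`
(`cexProfile_coloop_row_fails`).  So no argument that sees only the rank profiles of the summands can prove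
the rows of a direct sum (in particular of two fat flats); the set structure is essential.  Both facts are finite
computations (`decide`).  No `def`, no `instance`, no notation.  Axioms: standard.
-/

namespace PercRepro

namespace ProfileCex

open Finset

/-- The rows `(q, u)`, `0 ≤ q < u ≤ 4`, of the array `N` hold: `Σ_{f ≥ u} N(q,f)·C(f,u−q) ≤ C(u,q)·Σ_f N(u,f)`. -/
theorem cexProfile_rows :
    ∀ q ∈ range 5, ∀ u ∈ range 5, q < u →
      ∑ f ∈ range 5, (if u ≤ f then
        (fun c f : ℕ => if (c, f) = (0, 4) ∨ (c, f) = (4, 0) then 1 else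
          if (c, f) = (1, 3) ∨ (c, f) = (3, 1) then 4 else
          if (c, f) = (2, 2) ∨ (c, f) = (2, 4) ∨ (c, f) = (4, 2) then 3 else 0) q f * f.choose (u - q) else 0) ≤
      u.choose q * ∑ f ∈ range 5,
        (fun c f : ℕ => if (c, f) = (0, 4) ∨ (c, f) = (4, 0) then 1 else
          if (c, f) = (1, 3) ∨ (c, f) = (3, 1) then 4 else
          if (c, f) = (2, 2) ∨ (c, f) = (2, 4) ∨ (c, f) = (4, 2) then 3 else 0) u f := by
  decide

/-- The row `(2, 3)` of the coloop convolution `N'(c, f) = N(c, f − 1) + N(c − 1, f)` FAILS: `36 > 30`. -/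
theorem cexProfile_coloop_row_fails :
    ¬ (∑ f ∈ range 6, (if 3 ≤ f then
        (fun c f : ℕ =>
          (if 1 ≤ f then (fun c f : ℕ => if (c, f) = (0, 4) ∨ (c, f) = (4, 0) then 1 else
            if (c, f) = (1, 3) ∨ (c, f) = (3, 1) then 4 else
            if (c, f) = (2, 2) ∨ (c, f) = (2, 4) ∨ (c, f) = (4, 2) then 3 else 0) c (f - 1) else 0) +
          (if 1 ≤ c then (fun c f : ℕ => if (c, f) = (0, 4) ∨ (c, f) = (4, 0) then 1 else
            if (c, f) = (1, 3) ∨ (c, f) = (3, 1) then 4 else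
            if (c, f) = (2, 2) ∨ (c, f) = (2, 4) ∨ (c, f) = (4, 2) then 3 else 0) (c - 1) f else 0)) 2 f *
          f.choose 1 else 0) ≤
      (3 : ℕ).choose 2 * ∑ f ∈ range 6,
        (fun c f : ℕ =>
          (if 1 ≤ f then (fun c f : ℕ => if (c, f) = (0, 4) ∨ (c, f) = (4, 0) then 1 else
            if (c, f) = (1, 3) ∨ (c, f) = (3, 1) then 4 else
            if (c, f) = (2, 2) ∨ (c, f) = (2, 4) ∨ (c, f) = (4, 2) then 3 else 0) c (f - 1) else 0) +
          (if 1 ≤ c then (fun c f : ℕ => if (c, f) = (0, 4) ∨ (c, f) = (4, 0) then 1 else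
            if (c, f) = (1, 3) ∨ (c, f) = (3, 1) then 4 else
            if (c, f) = (2, 2) ∨ (c, f) = (2, 4) ∨ (c, f) = (4, 2) then 3 else 0) (c - 1) f else 0)) 3 f) := by
  decide

/-- The SHIFTED rows `(R_t)`, `b, e, t ≤ 4`, of the array `N` hold as well:
`Σ_{f ≥ b+e+t} N(b,f)·C(f,e) ≤ C(b+e+t, b+t)·Σ_f N(b+e+t, f)` — so the shifted rows are not a family closed under
adding a coloop either. -/
theorem cexProfile_shifted_rows :
    ∀ b ∈ range 5, ∀ e ∈ range 5, ∀ t ∈ range 5,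
      ∑ f ∈ range 5, (if b + e + t ≤ f then
        (fun c f : ℕ => if (c, f) = (0, 4) ∨ (c, f) = (4, 0) then 1 else
          if (c, f) = (1, 3) ∨ (c, f) = (3, 1) then 4 else
          if (c, f) = (2, 2) ∨ (c, f) = (2, 4) ∨ (c, f) = (4, 2) then 3 else 0) b f * f.choose e else 0) ≤
      (b + e + t).choose (b + t) * ∑ f ∈ range 5,
        (fun c f : ℕ => if (c, f) = (0, 4) ∨ (c, f) = (4, 0) then 1 else
          if (c, f) = (1, 3) ∨ (c, f) = (3, 1) then 4 else
          if (c, f) = (2, 2) ∨ (c, f) = (2, 4) ∨ (c, f) = (4, 2) then 3 else 0) (b + e + t) f := by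
  decide

end ProfileCex

end PercRepro
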